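import Summits.Ventures.PackingBounds.Energy.FivePointCkTwoDefs
import HarnessLib

/-!
# `FivePointCkTwo`: the SOS term with multiplier `s2Q2` — face basis, Gram form `yᵀ Y y` and its weighted-squares decomposition

Framing: lottery ticket; floor = certified bounds/negative ranges. Venture `PackingBounds`, cell
`pub-packcert`, energy family E3PT (pub-packcert-energy gen 11).
-/

noncomputable section

namespace Summit.Ventures.PackingBounds.Energy.FivePointCkTwo

/-- Face basis of the SOS term with multiplier `s2Q2`: 3 trivariate polynomials (columns of the certificate's `P`). -/
def wv_s2Q2 (u v t : ℝ) : ℕ → ℝ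
  | 0 => ((-1) : ℝ) * v * t + (1 : ℝ) * u * t
  | 1 => ((-1) : ℝ) * v * t + (1 : ℝ) * u * v
  | 2 => ((1 : ℝ)/2) + ((3 : ℝ)/2) * t + (1 : ℝ) * t^2 + ((3 : ℝ)/2) * v + (4 : ℝ) * v * t + (1 : ℝ) * v^2 + ((3 : ℝ)/2) * u + (1 : ℝ) * u^2
  | _ => 0

set_option maxRecDepth 20000 in
set_option maxHeartbeats 20000000 in
/-- Gram form `yᵀ Y y` of the SOS term `s2Q2` (chunk 0). -/
def quad_s2_0Q2 (y : ℕ → ℝ) : ℝ :=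
  ((70873 : ℝ)/268435456) * y 0^2 + ((70873 : ℝ)/268435456) * y 1^2 + ((70873 : ℝ)/268435456) * y 2^2

/-- Gram form of the SOS term `s2Q2` (assembled). -/
def quad_s2Q2 (y : ℕ → ℝ) : ℝ := quad_s2_0Q2 y

set_option maxRecDepth 20000 in
set_option maxHeartbeats 20000000 in
/-- Cholesky squares of the term `s2Q2` (chunk 0). -/
def sq_s2_0Q2 (y : ℕ → ℝ) : ℝ :=
  (((76603483 : ℝ)/17179869184) * y 0)^2 + (((76603483 : ℝ)/17179869184) * y 1)^2 + (((76603483 : ℝ)/17179869184) * y 2)^2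

set_option maxRecDepth 20000 in
set_option maxHeartbeats 20000000 in
/-- Remainder diagonal of the term `s2Q2` (chunk 0). -/
def dg_s2_0Q2 (y : ℕ → ℝ) : ℝ :=
  ((72057593987637159 : ℝ)/295147905179352825856) * y 0^2 + ((72057593987637159 : ℝ)/295147905179352825856) * y 1^2 + ((72057593987637159 : ℝ)/295147905179352825856) * y 2^2

/-- Decomposition of `quad_s2Q2` into nonnegatively weighted squares (assembled). -/
def sos_s2Q2 (y : ℕ → ℝ) : ℝ := sq_s2_0Q2 y + dg_s2_0Q2 y

set_option maxRecDepth 20000 in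
/-- The chunk `sq_s2_0Q2` is a nonnegative combination of squares. -/
theorem sq_s2_0_nonnegQ2 (y : ℕ → ℝ) : 0 ≤ sq_s2_0Q2 y := by
  unfold sq_s2_0Q2; positivity

set_option maxRecDepth 20000 in
/-- The chunk `dg_s2_0Q2` is a nonnegative combination of squares. -/
theorem dg_s2_0_nonnegQ2 (y : ℕ → ℝ) : 0 ≤ dg_s2_0Q2 y := by
  unfold dg_s2_0Q2; positivity

set_option maxRecDepth 20000 in
set_option maxHeartbeats 400000000 in
/-- `yᵀ Y y` of the term `s2Q2` equals its weighted sum of squares (`ring`). -/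
theorem quad_s2_eqQ2 (y : ℕ → ℝ) : quad_s2Q2 y = sos_s2Q2 y := by
  unfold quad_s2Q2 sos_s2Q2 quad_s2_0Q2 sq_s2_0Q2 dg_s2_0Q2
  ring

/-- The Gram block of the term `s2Q2` is positive semidefinite. -/
theorem quad_s2_nonnegQ2 (y : ℕ → ℝ) : 0 ≤ quad_s2Q2 y := by
  rw [quad_s2_eqQ2]; unfold sos_s2Q2
  linarith [sq_s2_0_nonnegQ2 y, dg_s2_0_nonnegQ2 y]

end Summit.Ventures.PackingBounds.Energy.FivePointCkTwo
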